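import Summits.ABC.IUTFork.Cor312TwoPlacePins
import Summits.ABC.IUTFork.Repair.CandMochizuki40TwoPlace
import HarnessLib

/-!
# IUT REPAIR branch (rung LADDER-ABC:A2.RP), row RP-M40b (seat abc-iut-rp-m4) — companion II: the PROTOCOL-GRADE T-c of the author's
# (EssGlIq) consistency claim `H'` on the PINNED two-place bed

Record file of the abc-iut cell's REPAIR branch (seat abc-iut-rp-m4; lead abc-iut-rp-plan). TAKES NO SIDE on [IUTchIII] Cor. 3.12 or on any
author; candidates are hypotheses (`Repair/CandMochizuki40`, p431550); PROOF-ONLY file. `Repair/CandMochizuki40TwoPlace` (p433915) read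
`H' := Statement ∧ ¬ Placewise` ([Rpt2024-03] (EssGlIq) `paper:url-b58939b9dc8f` p. 7 l. 41–44) off the two-place bed; part III of the bed
(`Cor312TwoPlacePins`, p434789) supplied abc-iut-w5-d230's THREE PINS there for the place-dependent log-shell operator `rho2` and
abc-iut-w4-d026's honest q-datum. THIS FILE assembles the T-c of record (REPAIR-SPEC §3): **`H'_satisfiable_pinned`** — typed Thm. 3.11 ∧
`BridgeHyps` ∧ `|log(q)| > 0` ∧ `PinnedRegions3` ∧ `H'`, together with `Statement` ∧ ¬Licence ∧ ¬`GapA3` ∧ ¬`GapH3` ∧ ¬S at the same pinned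
reading (honest `j²`-scaled Θ-images and honest q at the deep place `0`; log-shell inflation `3` in the operator at the place `1`); and
`H'_pinned_profile` at general `p`. Grade word for the row (lead's): SAT at two places, pinned. Nothing asserted about print; standard axioms.
[claim: Mochizuki2012, status: disputed]
-/

noncomputable section

open Set

namespace Summit.ABC.IUTFork.Repair.CandMochizuki40

open Thm311 Cor312 Cor312Vol Cor312Vol.TwoPlace Cor312Vol.NaiveProv Literature.IUT.LogThetaLattice

variable (p : ℕ) [hp : Fact p.Prime] (c : ℝ)

/-- **The pinned profile at the two-place setting of record** (`c > 0`): the three pins hold for `(rho2 p depth, qDatum)`, `H'` holds, and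
the residual S, `GapA3`, `GapH3` and the Licence all fail for that reading. [claim: Mochizuki2012, status: disputed] -/
theorem H'_pinned_profile (hc : 0 < c) :
    PinnedRegions3 (twoFull p c).toLatticeSituation (twoSetting p c depth) (rho2 p depth) (qDatum p (0 : twoIndex.V) trivial c) ∧
      H' (twoSetting p c depth) ∧
      ¬ PilotKummerIndRelated (twoFull p c).toLatticeSituation (twoSetting p c depth) (rho2 p depth)
        (qDatum p (0 : twoIndex.V) trivial c) ∧
      ¬ GapA3 (twoFull p c).toLatticeSituation (twoSetting p c depth) (rho2 p depth) (qDatum p (0 : twoIndex.V) trivial c) ∧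
      ¬ GapH3 (twoFull p c).toLatticeSituation (twoSetting p c depth) (rho2 p depth) (qDatum p (0 : twoIndex.V) trivial c) ∧
      ¬ Thm311ToCor312.Licence (twoSetting p c depth) :=
  ⟨two_pinnedRegions3 p c depth, H'_two p c hc, two_pinned_not_S p c, two_pinned_not_gapA3 p c, two_pinned_not_gapH3 p c,
    two_not_licence p c⟩

omit hp in
/-- **T-c OF RECORD for RP-M40b (`H'_satisfiable_pinned`)**: typed Thm. 3.11 ∧ `BridgeHyps` ∧ `|log(q)| > 0` ∧ `PinnedRegions3` ∧ `H'`
jointly satisfiable — at the PINNED two-place bed (`p = 2`, `c = log 2`, inflation profile `(0, 3)`), where moreover the typed Statement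
HOLDS and S, `GapA3`, `GapH3` and the Licence FAIL: the author's «essentially global» situation, pin-respecting, with no packetwise supplier.
[claim: Mochizuki2012, status: disputed] -/
theorem H'_satisfiable_pinned :
    ∃ (T : ThetaIndex) (F : FullSituation T) (P : Cor312.Setting F.toLatticeSituation.toSituation)
      (ρ : (∀ v : T.V, v ∈ T.Vbad → Set (F.L.StarPacket v)) → ∀ (j : T.Label) (vQ : T.VQ), Set (F.L.Packet j vQ))
      (qK : ∀ v : T.V, v ∈ T.Vbad → Set (F.L.StarPacket v)),
      F.Statement ∧ BridgeHyps P ∧ P.AbsLogQPos ∧ PinnedRegions3 F.toLatticeSituation P ρ qK ∧ H' P ∧ P.Statement ∧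
        ¬ PilotKummerIndRelated F.toLatticeSituation P ρ qK ∧ ¬ GapA3 F.toLatticeSituation P ρ qK ∧
        ¬ GapH3 F.toLatticeSituation P ρ qK ∧ ¬ Thm311ToCor312.Licence P := by
  haveI : Fact (Nat.Prime 2) := ⟨Nat.prime_two⟩
  have hc : 0 < Real.log 2 := Real.log_pos (by norm_num)
  exact ⟨twoIndex, twoFull 2 (Real.log 2), twoSetting 2 (Real.log 2) depth, rho2 2 depth, qDatum 2 (0 : twoIndex.V) trivial (Real.log 2),
    twoFull_statement 2 _, two_bridgeHyps 2 _ depth hc.le, two_absLogQPos 2 _ depth hc, two_pinnedRegions3 2 _ depth, H'_two 2 _ hc,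
    two_statement 2 _ hc, two_pinned_not_S 2 _, two_pinned_not_gapA3 2 _, two_pinned_not_gapH3 2 _, two_not_licence 2 _⟩

end Summit.ABC.IUTFork.Repair.CandMochizuki40

end
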